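import Literature.AlgebraicGeometry.HodgeTheory.SupportedClassesOfChowZeroRankOne
import Literature.AlgebraicGeometry.HodgeTheory.ComplexOrientationDegreeFormulaHolds
import HarnessLib

/-!
# Small Chow groups force geometric coniveau: `CH₀, …, CH_{k₀}` of rank `≤ 1` ⟹ `N^{k₀+1} Hᵏ = Hᵏ` for every
# `k > 2k₀` (Laterveer 1998 / Paranjape 1994; Voisin II Thm. 10.29 and the mechanism of Thm. 10.31) — PROVED

Family `hodge`, layer `Literature/AlgebraicGeometry/HodgeTheory`; sequel of `SupportedClassesOfChowZeroRankOne` (the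
case `k₀ = 0`: Bloch–Srinivas, `CH₀(X)_ℚ = ℚ ⟹ N¹ Hᵏ = Hᵏ` for `k ≥ 1`). THEOREMS ONLY (no definition, no named
fact; D-0026 net debt `0`). Written for the cell `hodge-nonav` (memo ROUTE-P3v20, LEMMA AB (3;5,5): the middle
cohomology `H⁵` of a smooth cubic fivefold has `CH₀ = CH₁ = ℚ` by Esnault–Levine–Viehweg, hence `H⁵ = N² H⁵`).

THE ARGUMENT (Voisin II §10.3.1, proof of Thm. 10.31, run in an arbitrary degree `k`; Laterveer 1998). Let `X` be
smooth projective of dimension `n` with `dim_ℚ CH_j(X)_ℚ ≤ 1` for `j ≤ k₀` (`Motives.ChowRankLEOneUpTo X k₀`). The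
generalised decomposition of the diagonal (Voisin II Thm. 10.29 — PROVED in the tree,
`Motives.ParanjapeLaterveer_generalisedDecompositionOfTheDiagonal_holds`) gives
`m[Δ_X] ∼_rat Z₀ + ⋯ + Z_{k₀} + Z'`, `m > 0`, with `Z_i` supported in `W'_i × W_i`, `dim W_i ≤ i`, and `Z'`
supported in `T × X`, `codim T ≥ k₀ + 1`. Let `[·]^*` be the action of correspondences on `Hᵏ(X(ℂ); ℂ)` for a
Gysin / cycle-class formalism `G` (Voisin II (10.7); `[Δ_X]^* = Id`, Lemma 9.18 for rational equivalence). For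
`k > 2k₀`: every prime component `V = closure {z}` of `Z_i` has `2 dim pr₂(z) ≤ 2i ≤ 2k₀ < k`, so `[V]^* = 0` on
`Hᵏ` (the tree's `GysinFormalism.corrAct_primeCycle_eq_zero_of_two_mul_height_snd_lt`: `[V]^*` factors through
`Hᵏ` of a desingularisation of `closure {pr₂ z}`, which vanishes above the real dimension); and `[Z']^*` maps `Hᵏ`
into the classes supported on `T`, i.e. into `N^{k₀+1} Hᵏ` (`GysinFormalism.corrAct_mem_supportedClasses_of_fst_mem`).
Hence `m c ∈ N^{k₀+1} Hᵏ` for every `c`, and `m` is invertible in `ℂ`.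

WHAT IS PROVED.
* `GysinFormalism.supportedClasses_eq_top_of_chowRankLEOneUpTo` — for a Gysin formalism `G` (parameter),
  `ChowRankLEOneUpTo X k₀` and `2k₀ + 1 ≤ k` ⟹ `supportedClasses X k (k₀ + 1) = ⊤`.
* **`supportedClasses_eq_top_of_chowRankLEOneUpTo`** — the same FORMALISM-FREE (a Gysin formalism exists:
  `exists_gysinFormalism_isGysinHodgeCompatible_complexOrientation_holds`), and the Chow-group form
  `supportedClasses_eq_top_of_chowGroups_rank_le_one`.
* `supportedClasses_five_two_eq_top_of_chowRankLEOneUpTo_one` — fivefolds with `CH₀, CH₁` of rank `≤ 1` have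
  `N² H⁵ = H⁵` (cubic fivefolds, granted Esnault–Levine–Viehweg).

## References
* [VoisinHodgeII2003] C. Voisin, *Hodge Theory and Complex Algebraic Geometry II* (2003) — Lemma 9.18, proof of
  Thm. 10.17 ((10.7)–(10.9)), Thm. 10.29, Thm. 10.31 (proof).
* [Laterveer1998] R. Laterveer, *Algebraic varieties with small Chow groups*, J. Math. Kyoto Univ. 38 (1998).
* [Paranjape1994SmallChow] K. Paranjape, *Cohomological and cycle-theoretic connectivity*, Ann. of Math. 139 (1994).
* [Vial2013] Ch. Vial, *Algebraic cycles and fibrations*, Doc. Math. 18 (2013) — proof of Thm. 7.1.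
* [BlochSrinivas1983] S. Bloch, V. Srinivas, Amer. J. Math. 105 (1983) — Thm. 1.

## Provenance
Cell `hodge-nonav` (summit `HodgeConjecture`, rung F-H1), seat `littype-FH1-2` (literature-prover, generation 17).
-/

noncomputable section

open CategoryTheory CategoryTheory.Limits AlgebraicGeometry MonoidalCategory CartesianMonoidalCategory

namespace Literature.AlgebraicGeometry.HodgeTheory

open Literature.AlgebraicGeometry.Motives
open Literature.AlgebraicTopology.SingularHomology

section HodgeTheory

variable {n : ℕ} {X : SchemeOver ℂ}

/-- **Laterveer / Voisin II Thm. 10.31 (mechanism), on the tree's carriers: `dim_ℚ CH_j(X)_ℚ ≤ 1` for `j ≤ k₀`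
⟹ `N^{k₀+1} Hᵏ(X(ℂ); ℂ) = Hᵏ(X(ℂ); ℂ)` for every `k ≥ 2k₀ + 1`**, granted a Gysin / cycle-class formalism `G`:
`m[Δ_X] ∼ Σ_{i ≤ k₀} Z_i + Z'` (generalised decomposition of the diagonal, PROVED), the `Z_i` act by zero on `Hᵏ`
(`2 dim pr₂ ≤ 2i ≤ 2k₀ < k`), `[Z']^*` lands in the classes supported on `T`, `codim T ≥ k₀ + 1`, and `m ≠ 0`.
[cite: VoisinHodgeII2003, Thm. 10.29 and proof of Thm. 10.31] [cite: Laterveer1998, main theorem (as quoted in Vial2013 Thm. 7.1)]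
[cite: BlochSrinivas1983, Thm. 1] -/
theorem GysinFormalism.supportedClasses_eq_top_of_chowRankLEOneUpTo (G : GysinFormalism)
    (hX : IsSmoothProjective n X) {k₀ : ℕ} (hCH : ChowRankLEOneUpTo X k₀) {k : ℕ} (hk : 2 * k₀ + 1 ≤ k) :
    supportedClasses X k (k₀ + 1) = ⊤ := by
  classical
  -- a generic point `δ` of the diagonal, and `[Δ]` as an `n`-cycle
  haveI := GysinFormalism.isClosedImmersion_diagonal_left hX
  haveI := irreducibleSpace_of_isSmoothProjective' hX
  set Δ := (lift (𝟙 X) (𝟙 X)).left with hΔ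
  obtain ⟨δ, hδ⟩ : ∃ δ : ↥(X ⊗ X).left, IsGenericPoint δ (Set.range Δ.base) := by
    refine ⟨Δ.base (genericPoint X.left), ?_⟩
    have h := (genericPoint_spec X.left).image Δ.base.hom.continuous
    rwa [Set.image_univ, Δ.isClosedEmbedding.isClosed_range.closure_eq] at h
  have hn : primeCycle δ ∈ cyclesOfDim (X ⊗ X).left n :=
    primeCycle_mem_cyclesOfDim (height_eq_of_isGenericPoint_diagonal' hX hδ)
  -- the generalised decomposition `m[Δ] ∼ Σ Z_i + Z'` (Thm. 10.29)
  obtain ⟨m, hm, T, hT, hcod, Z', hZ', hZ'T, Z, W, W', hZ, -, hWdim, -, hsupp, hrat⟩ :=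
    ParanjapeLaterveer_generalisedDecompositionOfTheDiagonal_holds hX hCH δ hδ
  have hrat' : IsRationallyEquivalent
      ((m • ⟨primeCycle δ, hn⟩ : ↥(cyclesOfDim (X ⊗ X).left n)) : AlgebraicCycle (X ⊗ X).left ℤ)
      (((∑ i, (⟨Z i, hZ i⟩ : ↥(cyclesOfDim (X ⊗ X).left n))) + ⟨Z', hZ'⟩ : ↥(cyclesOfDim (X ⊗ X).left n)) :
        AlgebraicCycle (X ⊗ X).left ℤ) n := by
    rw [AddSubgroup.coe_add, AddSubgroup.val_finsetSum]
    exact hrat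
  -- Lemma 9.18 and `[Δ]^* = Id`: `m • c = Σ [Z_i]^*c + [Z']^*c`
  have hact := G.corrAct_congr hX hX k hrat'
  rw [map_nsmul, map_add, map_sum, G.corrAct_primeCycle_diagonal hX k δ hδ hn] at hact
  refine eq_top_iff.2 fun c _ ↦ ?_
  have hmc : (m : ℂ) • c =
      (∑ i, G.corrAct hX hX k ⟨Z i, hZ i⟩ c) + G.corrAct hX hX k ⟨Z', hZ'⟩ c := by
    have h := LinearMap.congr_fun hact c
    simp only [LinearMap.smul_apply, LinearMap.id_apply, LinearMap.add_apply, LinearMap.sum_apply] at h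
    rw [← h, Nat.cast_smul_eq_nsmul ℂ m c]
  have hmem : (m : ℂ) • c ∈ supportedClasses X k (k₀ + 1) := by
    rw [hmc]
    refine add_mem (Submodule.sum_mem _ fun i _ ↦ ?_)
      (G.corrAct_mem_supportedClasses_of_fst_mem hX k hT (fun t ht ↦ by exact_mod_cast hcod t ht) hZ'T c)
    -- `[Z_i]^*c = 0`: every component lies over a point of `W_i`, `dim W_i ≤ i ≤ k₀ < k/2`
    refine G.corrAct_mem_of_primeCycle hX hX k _ ⟨Z i, hZ i⟩ c fun z hz0 hz ↦ ?_
    have hi : Order.height ((snd X X).left.base z) ≤ ((i : ℕ) : ℕ∞) := hWdim i _ (hsupp i z hz0).2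
    rw [G.corrAct_primeCycle_eq_zero_of_two_mul_height_snd_lt hX z hz (hZ i z hz0) ?_ c]
    · exact Submodule.zero_mem _
    · have hik : 2 * ((i : ℕ) : ℕ∞) < (k : ℕ∞) := by
        have : 2 * (i : ℕ) < k := by have := i.isLt; omega
        exact_mod_cast this
      exact lt_of_le_of_lt (mul_le_mul_right hi 2) hik
  -- and `m` is invertible in `ℂ`
  have hm0 : (m : ℂ) ≠ 0 := by exact_mod_cast hm.ne'
  rwa [Submodule.smul_mem_iff _ hm0] at hmem

/-- **`CH₀, …, CH_{k₀}` of rank `≤ 1` ⟹ `N^{k₀+1} Hᵏ = Hᵏ` for `k ≥ 2k₀ + 1`, FORMALISM-FREE** (a Gysin /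
cycle-class formalism exists unconditionally: the complex orientations,
`exists_gysinFormalism_isGysinHodgeCompatible_complexOrientation_holds`). For `k₀ = 0` this is Bloch–Srinivas /
Voisin 2025 Cor. 5.7 (`supportedClasses_eq_top_of_chowRankLEOneUpTo_zero`).
[cite: VoisinHodgeII2003, Thm. 10.29 and proof of Thm. 10.31] [cite: Laterveer1998, main theorem (as quoted in Vial2013 Thm. 7.1)] -/
theorem supportedClasses_eq_top_of_chowRankLEOneUpTo (hX : IsSmoothProjective n X) {k₀ : ℕ}
    (hCH : ChowRankLEOneUpTo X k₀) {k : ℕ} (hk : 2 * k₀ + 1 ≤ k) : supportedClasses X k (k₀ + 1) = ⊤ := by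
  obtain ⟨G, -⟩ := exists_gysinFormalism_isGysinHodgeCompatible_complexOrientation_holds
  exact G.supportedClasses_eq_top_of_chowRankLEOneUpTo hX hCH hk

/-- The same with the hypothesis on the Chow GROUPS `CH_j(X) = Z_j/Rat_j` (`Motives.ChowGroup`): if for every
`j ≤ k₀` any two classes of `CH_j(X)` are `ℤ`-linearly dependent, then `N^{k₀+1} Hᵏ(X(ℂ); ℂ) = Hᵏ(X(ℂ); ℂ)` for
`k ≥ 2k₀ + 1`. [cite: VoisinHodgeII2003, Thm. 10.29 and proof of Thm. 10.31] -/
theorem supportedClasses_eq_top_of_chowGroups_rank_le_one (hX : IsSmoothProjective n X) {k₀ : ℕ}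
    (hCH : ∀ j ≤ k₀, ∀ a b : ChowGroup X.left j, ∃ p q : ℤ, (p ≠ 0 ∨ q ≠ 0) ∧ p • a = q • b) {k : ℕ}
    (hk : 2 * k₀ + 1 ≤ k) : supportedClasses X k (k₀ + 1) = ⊤ :=
  supportedClasses_eq_top_of_chowRankLEOneUpTo hX ((chowRankLEOneUpTo_iff_chowGroup X k₀).2 hCH) hk

/-- **Fivefolds with `CH₀` and `CH₁` of rank `≤ 1` have `N² H⁵ = H⁵`** (their middle cohomology is supported in
codimension `2`; e.g. smooth cubic fivefolds, by Esnault–Levine–Viehweg `C(4,2) = 6 ≤ 6`).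
[cite: VoisinHodgeII2003, proof of Thm. 10.31] [cite: Laterveer1998, main theorem (as quoted in Vial2013 Thm. 7.1)] -/
theorem supportedClasses_five_two_eq_top_of_chowRankLEOneUpTo_one (hX : IsSmoothProjective 5 X)
    (hCH : ChowRankLEOneUpTo X 1) : supportedClasses X 5 2 = ⊤ :=
  supportedClasses_eq_top_of_chowRankLEOneUpTo hX hCH (k := 5) (by norm_num)

end HodgeTheory

end Literature.AlgebraicGeometry.HodgeTheory

end
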